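import Summits.AtomisticToContinuum.BoseEinsteinCondensation.Theses.BECHeatBathGap
import Summits.AtomisticToContinuum.BoseEinsteinCondensation.Theorems.BECCutLineWeakDisorderGroundStateRigidityLocBddAllDensities
import Summits.AtomisticToContinuum.BoseEinsteinCondensation.Theorems.BECHeatBathGapSquareSummableInfluenceStubInfluenceLipschitz
import Summits.AtomisticToContinuum.BoseEinsteinCondensation.Theorems.BECHeatBathGapSquareSummableInfluenceStubInfluenceLipschitzState
import Summits.AtomisticToContinuum.BoseEinsteinCondensation.Theorems.BECHeatBathGapSquareSummableInfluenceStubGroundStateApprox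
import Literature.MathematicalPhysics.QuantumManyBody.GroundState
import Literature.MathematicalPhysics.QuantumManyBody.OneParticleMarginals
import Literature.MathematicalPhysics.QuantumManyBody.BoseGasDirichletWall
import HarnessLib

/-!
# Route `BECHeatBathGap`, crux `SquareSummableInfluence` (stmt-AtomisticToContinuum-14368), line `registered`:
# the crux reduced to its two kernels

Supports (does not close) stmt-AtomisticToContinuum-14368 (lead c1). The registered skeleton v2 of the line
(`Cruxes/SquareSummableInfluence/Lines/birth.lean`) concludes the crux `SquareSummableInfluence` — for every
repulsive finite-range `v` and `ε > 0`, at low density and eventually in `N`, some slack `δ₂ > 0` makes EVERY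
`δ₂`-near-minimiser `Θ` of the `N`-body Dirichlet energy in the box of side `((N+1)/ρ)^{1/3}` predictable
particle-by-particle, at every slack `δ`, by SOME `δ`-near-minimiser `Ψ` of the `(N+1)`-body energy with
bounded measurable predictors `g_i` blind to `x_i` and total squared influence `≤ ε` — from five stubs used by
name. Three of them (the frame) are landed theorems of this namespace (`stub_influenceLipschitz`,
`stub_influenceLipschitzState`, `stub_groundStateApprox`); this file is the sorry-free composition with the two
remaining KERNELS written out verbatim as hypotheses:

* `h1` = the registered stub `stub_groundStateInfluence` (the physics of card A2): at low density and eventually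
  in `N` there are closed-form ground states `Θ₀` (`N` bodies) and `Ψ₀` (`N+1` bodies) in the `(N+1)`-box and
  bounded measurable blind predictors with `∑_i ∫_{Λ^{N+1}} |Ψ₀ − g_i Θ₀(tail)|² ≤ ε` (the dressed
  Reatto–Chester `r⁻²` influence tail of the TRUE ground state; open);
* `h2` = the registered stub `stub_levelUniqueWall` (the open kernel of the shared crux `GroundStateRigidity`,
  stmt-AtomisticToContinuum-9072, read in the `(N+1)`-box): nondegeneracy of the `N`-body ground state for
  admissible `v` that are NOT essentially locally bounded on `(0, ∞)`; the complementary class is the theorem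
  `hasUniqueGroundState_of_essLocBdd'`.

`squareSummableInfluence_of_kernels : h1 → h2 → SquareSummableInfluence`. Proof: physics witness at `ε/8`;
uniqueness at level `N` ⇒ rigidity of near-minimisers (`stub_rigidityOfUnique stub_compactness`) at scale
`η₁ = ε/4/(16K+1)`, `K = N M² L'³`; `δ₂ :=` the rigidity slack; a `δ₂`-near-minimiser `Θ'` within `η₁` of `Θ₀`
and, for each `δ`, a `δ`-near-minimiser `Ψ` within `η₂ = ε/8/(2N+1)` of `Ψ₀` (`stub_groundStateApprox`); for an
arbitrary `δ₂`-near-minimiser `Θ` rigidity gives a phase `c` with `∫|Θ' − cΘ|² ≤ η₁`, so `∫|Θ₀ − cΘ|² ≤ 4η₁`;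
predictors `c·g_i`; the two Lipschitz lemmas give influence `≤ 2(2·ε/8 + 2K·4η₁) + 2Nη₂ ≤ ε`.
Corollary `squareSummableInfluence_of_groundStateInfluence_of_groundStateRigidityKernel`: not stated — the
wall kernel is exactly `h2`.
-/

noncomputable section

open MeasureTheory Filter
open scoped ENNReal NNReal

namespace Summit.AtomisticToContinuum.BoseEinsteinCondensation.Theorems.SquareSummableInfluence

open Literature.MathematicalPhysics.QuantumManyBody.BoseGas
open Summit.AtomisticToContinuum.BoseEinsteinCondensation.Theorems.GroundStateRigidity

/-- **The crux `SquareSummableInfluence` from its two kernels** (physics: square-summable influence of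
the true ground-state pair, `h1` = registered stub `stub_groundStateInfluence`; nondegeneracy of the
`N`-body ground state for hard-wall potentials in the `(N+1)`-box, `h2` = registered stub
`stub_levelUniqueWall`), via the landed frame (`stub_groundStateApprox`, `stub_influenceLipschitzState`,
`stub_influenceLipschitz`), rigidity from uniqueness (`stub_rigidityOfUnique stub_compactness`) and
uniqueness for essentially locally bounded potentials (`hasUniqueGroundState_of_essLocBdd'`).
[cite: ReedSimonIV1978, §XIII.12 Thm XIII.47] -/
theorem squareSummableInfluence_of_kernels :
    (∀ v : ℝ → ℝ≥0∞, IsRepulsiveFiniteRange v → ∀ ε : ℝ, 0 < ε →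
      ∃ ρ₀ : ℝ, 0 < ρ₀ ∧ ∀ ρ : ℝ, 0 < ρ → ρ < ρ₀ → ∀ᶠ N : ℕ in atTop,
        ∃ (Θ₀ : Config N → ℂ) (Ψ₀ : Config (N + 1) → ℂ),
          IsGroundState v (sideLength ρ (N + 1)) Θ₀ ∧ IsGroundState v (sideLength ρ (N + 1)) Ψ₀ ∧
          ∃ g : Fin N → Config (N + 1) → ℂ,
            (∀ i, Measurable (g i)) ∧ (∃ M : ℝ, ∀ i Z, ‖g i Z‖ ≤ M) ∧
            (∀ i Z x, g i (Function.update Z (Fin.succ i) x) = g i Z) ∧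
            (∑ i : Fin N, ∫⁻ Z in boxN (N + 1) (sideLength ρ (N + 1)),
                (‖Ψ₀ Z - g i Z * Θ₀ (Matrix.vecTail Z)‖₊ : ℝ≥0∞) ^ 2) ≤ ENNReal.ofReal ε) →
    (∀ v : ℝ → ℝ≥0∞, IsRepulsiveFiniteRange v →
      (¬ ∀ r : ℝ, 0 < r → ∃ C : ℝ≥0, ∀ᵐ s : ℝ, r ≤ s → v s ≤ C) →
      ∃ ρ₀ : ℝ, 0 < ρ₀ ∧ ∀ ρ : ℝ, 0 < ρ → ρ < ρ₀ → ∀ᶠ N : ℕ in atTop,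
        HasUniqueGroundState v N (sideLength ρ (N + 1))) →
    Summit.AtomisticToContinuum.BoseEinsteinCondensation.Theses.BECHeatBathGap.SquareSummableInfluence := by
  intro h1 h2
  have h3 := stub_influenceLipschitz
  have h4 := stub_influenceLipschitzState
  have h5 := stub_groundStateApprox
  intro v hv ε hε
  obtain ⟨ρ₁, hρ₁, H1⟩ := h1 v hv (ε / 8) (by positivity)
  -- uniqueness of the `N`-body ground state in the `(N+1)`-box, eventually, at low density
  obtain ⟨ρ₂, hρ₂, H2⟩ : ∃ ρ₂ : ℝ, 0 < ρ₂ ∧ ∀ ρ : ℝ, 0 < ρ → ρ < ρ₂ → ∀ᶠ N : ℕ in atTop,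
      HasUniqueGroundState v N (sideLength ρ (N + 1)) := by
    by_cases hlb : ∀ r : ℝ, 0 < r → ∃ C : ℝ≥0, ∀ᵐ s : ℝ, r ≤ s → v s ≤ C
    · refine ⟨1, one_pos, fun ρ hρ _ => ?_⟩
      filter_upwards [eventually_ge_atTop 1] with N hN
      exact hasUniqueGroundState_of_essLocBdd' N v (sideLength ρ (N + 1)) hN
        (sideLength_pos_of_pos hρ (Nat.succ_pos N)) hv.1 hlb
    · exact h2 v hv hlb
  refine ⟨min ρ₁ ρ₂, lt_min hρ₁ hρ₂, fun ρ hρ hρlt => ?_⟩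
  filter_upwards [H1 ρ hρ (hρlt.trans_le (min_le_left _ _)),
    H2 ρ hρ (hρlt.trans_le (min_le_right _ _))] with N hN1 hN2
  obtain ⟨Θ₀, Ψ₀, hΘ₀, hΨ₀, g, hgm, ⟨M, hgb⟩, hgu, hsum⟩ := hN1
  set L : ℝ := sideLength ρ (N + 1) with hL
  have hL0 : 0 ≤ L := (sideLength_pos_of_pos hρ (Nat.succ_pos N)).le
  -- constants: `K = N M² L³ ≥ 0`, `η₁ = ε/4/(16K+1)`, `η₂ = ε/8/(2N+1)`
  set K : ℝ := (N : ℝ) * (M ^ 2 * L ^ 3) with hK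
  have hK0 : 0 ≤ K := by positivity
  set η₁ : ℝ := ε / 4 / (16 * K + 1) with hη₁
  have hη₁pos : 0 < η₁ := by positivity
  set η₂ : ℝ := ε / 8 / (2 * N + 1) with hη₂
  have hη₂pos : 0 < η₂ := by positivity
  -- rigidity of near-minimisers at level `N` (compactness + uniqueness, landed for stmt-9072)
  obtain ⟨δ₂, hδ₂, hrig⟩ := stub_rigidityOfUnique stub_compactness v N L hN2 η₁ hη₁pos
  -- a `δ₂`-near-minimiser `Θ'` within `η₁` of the ground state `Θ₀`
  obtain ⟨Θ', hΘ'e, hΘ'd⟩ := h5 N L v Θ₀ hΘ₀ δ₂ hδ₂ η₁ hη₁pos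
  refine ⟨δ₂, hδ₂, fun Θ hΘ δ hδ => ?_⟩
  -- the phase: `∫ |Θ' − c Θ|² ≤ η₁`
  obtain ⟨c, hc, hcd⟩ := hrig Θ' Θ hΘ'e hΘ
  -- a `δ`-near-minimiser `Ψ` within `η₂` of the ground state `Ψ₀`
  obtain ⟨Ψ, hΨe, hΨd⟩ := h5 (N + 1) L v Ψ₀ hΨ₀ δ hδ η₂ hη₂pos
  refine ⟨Ψ, hΨe, fun i Z => c * g i Z, fun i => (hgm i).const_mul c, ⟨M, fun i Z => ?_⟩,
    fun i Z x => ?_, ?_⟩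
  · show ‖c * g i Z‖ ≤ M
    rw [norm_mul, hc, one_mul]
    exact hgb i Z
  · show c * g i (Function.update Z (Fin.succ i) x) = c * g i Z
    rw [hgu]
  · show (∑ i : Fin N, ∫⁻ Z in boxN (N + 1) L,
        (‖Ψ.ψ Z - c * g i Z * Θ.ψ (Matrix.vecTail Z)‖₊ : ℝ≥0∞) ^ 2) ≤ ENNReal.ofReal ε
    have hΘm : Measurable Θ.ψ := Θ.contDiff.continuous.measurable
    have hΘ'm : Measurable Θ'.ψ := Θ'.contDiff.continuous.measurable
    have hΨm : Measurable Ψ.ψ := Ψ.contDiff.continuous.measurable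
    have htail : Measurable fun Z : Config (N + 1) => Matrix.vecTail Z := measurable_vecTail
    -- `∫ |Θ₀ − c Θ|² ≤ 4 η₁`
    have hd1 : ∫⁻ X, (‖Θ₀ X - c * Θ.ψ X‖₊ : ℝ≥0∞) ^ 2 ≤ ENNReal.ofReal (4 * η₁) := by
      have hm2 : Measurable fun X => (‖Θ'.ψ X - Θ₀ X‖₊ : ℝ≥0∞) ^ 2 :=
        (hΘ'm.sub hΘ₀.measurable).nnnorm.coe_nnreal_ennreal.pow_const 2
      have hm1 : Measurable fun X => 2 * (‖Θ'.ψ X - Θ₀ X‖₊ : ℝ≥0∞) ^ 2 := hm2.const_mul 2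
      have hm3 : Measurable fun X => (‖Θ'.ψ X - c * Θ.ψ X‖₊ : ℝ≥0∞) ^ 2 :=
        (hΘ'm.sub (measurable_const.mul hΘm)).nnnorm.coe_nnreal_ennreal.pow_const 2
      calc ∫⁻ X, (‖Θ₀ X - c * Θ.ψ X‖₊ : ℝ≥0∞) ^ 2
          ≤ ∫⁻ X, 2 * (‖Θ'.ψ X - Θ₀ X‖₊ : ℝ≥0∞) ^ 2 +
              2 * (‖Θ'.ψ X - c * Θ.ψ X‖₊ : ℝ≥0∞) ^ 2 := by
            refine lintegral_mono fun X => ?_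
            have h := coe_nnnorm_add_sq_le (-(Θ'.ψ X - Θ₀ X)) (Θ'.ψ X - c * Θ.ψ X)
            rw [nnnorm_neg] at h
            rwa [show -(Θ'.ψ X - Θ₀ X) + (Θ'.ψ X - c * Θ.ψ X) = Θ₀ X - c * Θ.ψ X by ring] at h
        _ = 2 * (∫⁻ X, (‖Θ'.ψ X - Θ₀ X‖₊ : ℝ≥0∞) ^ 2) +
              2 * (∫⁻ X, (‖Θ'.ψ X - c * Θ.ψ X‖₊ : ℝ≥0∞) ^ 2) := by
            rw [lintegral_add_left hm1, lintegral_const_mul _ hm2, lintegral_const_mul _ hm3]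
        _ ≤ 2 * ENNReal.ofReal η₁ + 2 * ENNReal.ofReal η₁ := by
            gcongr
        _ = ENNReal.ofReal (4 * η₁) := by
            rw [ENNReal.ofReal_mul (by norm_num : (0 : ℝ) ≤ 4), ENNReal.ofReal_ofNat]
            ring
    -- Stub 4 (Lipschitz in the state) with `h_i = c g_i Θ(tail)`
    have hhm : ∀ i, Measurable fun Z : Config (N + 1) => c * g i Z * Θ.ψ (Matrix.vecTail Z) :=
      fun i => (measurable_const.mul (hgm i)).mul (hΘm.comp htail)
    have hstep1 := h4 N L Ψ.ψ Ψ₀ (fun i Z => c * g i Z * Θ.ψ (Matrix.vecTail Z)) hΨm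
      hΨ₀.measurable hhm
    -- Stub 3 (Lipschitz in the bath state) between `Θ₀` and `c Θ`
    have hstep2 := h3 N L Ψ₀ Θ₀ Θ.ψ g M c hΨ₀.measurable hΘ₀.measurable hΘm hgm hgb
    -- arithmetic of the constants
    have hfin : 2 * (2 * (ε / 8) + 2 * (N : ℝ) * (M ^ 2 * L ^ 3) * (4 * η₁)) + 2 * (N : ℝ) * η₂ ≤ ε := by
      have hA : 2 * (N : ℝ) * (M ^ 2 * L ^ 3) * (4 * η₁) = (ε / 8) * (16 * K / (16 * K + 1)) := by
        rw [hη₁, hK]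
        field_simp
        ring
      have hA' : 16 * K / (16 * K + 1) ≤ 1 := by
        rw [div_le_one (by positivity)]
        linarith
      have hB : 2 * (N : ℝ) * η₂ = (ε / 8) * (2 * N / (2 * N + 1)) := by
        rw [hη₂]
        field_simp
      have hB' : 2 * (N : ℝ) / (2 * N + 1) ≤ 1 := by
        rw [div_le_one (by positivity)]
        linarith
      rw [hA, hB]
      have h1' : (ε / 8) * (16 * K / (16 * K + 1)) ≤ ε / 8 * 1 := by gcongr
      have h2' : (ε / 8) * (2 * N / (2 * N + 1)) ≤ ε / 8 * 1 := by gcongr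
      linarith
    have hcast : (2 : ℝ≥0∞) * (2 * ENNReal.ofReal (ε / 8) +
        2 * (N : ℝ≥0∞) * ENNReal.ofReal (M ^ 2 * L ^ 3) * ENNReal.ofReal (4 * η₁)) +
        2 * (N : ℝ≥0∞) * ENNReal.ofReal η₂ =
        ENNReal.ofReal (2 * (2 * (ε / 8) + 2 * (N : ℝ) * (M ^ 2 * L ^ 3) * (4 * η₁)) +
          2 * (N : ℝ) * η₂) := by
      have hML : 0 ≤ M ^ 2 * L ^ 3 := by positivity
      simp (disch := positivity) only [ENNReal.ofReal_add, ENNReal.ofReal_mul, ENNReal.ofReal_ofNat,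
        ENNReal.ofReal_natCast]
    calc (∑ i : Fin N, ∫⁻ Z in boxN (N + 1) L,
          (‖Ψ.ψ Z - c * g i Z * Θ.ψ (Matrix.vecTail Z)‖₊ : ℝ≥0∞) ^ 2)
        ≤ 2 * (∑ i : Fin N, ∫⁻ Z in boxN (N + 1) L,
              (‖Ψ₀ Z - c * g i Z * Θ.ψ (Matrix.vecTail Z)‖₊ : ℝ≥0∞) ^ 2) +
            2 * (N : ℝ≥0∞) * ∫⁻ Z, (‖Ψ.ψ Z - Ψ₀ Z‖₊ : ℝ≥0∞) ^ 2 := hstep1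
      _ ≤ 2 * (2 * (∑ i : Fin N, ∫⁻ Z in boxN (N + 1) L,
              (‖Ψ₀ Z - g i Z * Θ₀ (Matrix.vecTail Z)‖₊ : ℝ≥0∞) ^ 2) +
            2 * (N : ℝ≥0∞) * ENNReal.ofReal (M ^ 2 * L ^ 3) *
              ∫⁻ X, (‖Θ₀ X - c * Θ.ψ X‖₊ : ℝ≥0∞) ^ 2) +
            2 * (N : ℝ≥0∞) * ENNReal.ofReal η₂ := by
          gcongr
      _ ≤ 2 * (2 * ENNReal.ofReal (ε / 8) +
            2 * (N : ℝ≥0∞) * ENNReal.ofReal (M ^ 2 * L ^ 3) * ENNReal.ofReal (4 * η₁)) +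
            2 * (N : ℝ≥0∞) * ENNReal.ofReal η₂ := by
          gcongr
      _ ≤ ENNReal.ofReal ε := by
          rw [hcast]
          exact ENNReal.ofReal_le_ofReal hfin

end Summit.AtomisticToContinuum.BoseEinsteinCondensation.Theorems.SquareSummableInfluence

end
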